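import Summits.QuantumFields.YangMills.Theorems.BalabanUVNodesN07Prop8StepTokenOfRecordSym152GCprimeDprime
import Summits.QuantumFields.YangMills.Theorems.BalabanUVNodesN07Prop8StepTokenOfRecordOfLettersSym152EGB
import Summits.QuantumFields.YangMills.Theorems.BalabanUVNodesN07HA1LamFreeB
import Summits.QuantumFields.YangMills.Theorems.BalabanUVNodesN07SymHQnearB
import HarnessLib

/-!
# N07 [B11] (= [15] = [Balaban1985Variational]) Sect. F — **MODULE 123 = EDITION 100⁵-G (Sym152EG, (c′) AND (d′)-Lam DISCHARGED)**: ✓p748785's `…Prop8StepTokenOfRecordSym152CprimeDprime` — **PRINT-DATUM EDITION (B): conclusion over `(lamDatum F, dataSmall7LamTopOf F N)`, NO SEAM**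
# (100⁵, the landed original this file is a TWIN of — №314 (g-1): token substitution only; statement shape identical; no new displayed hypothesis) VERBATIM except that the ONE
# conditional premise is the GUARD EDITION (c-ii)‴ `hT : HThm4RecSym152PhiEG F N Mc ρ (F.L * Mh) κ a₀ Ψ` (MODULE 121; candidate (β′), plan g94 WORD (B) 2026-08-30) and the composition
# runs through MODULE 122 (`prop8RegSepTopStepG_of_hThm4RecSym152EG_of_letters`) — 99″ `hQnear_symPhiE_of_guards` and 117′ `hA1_lam_free` unchanged.  Everything below is 100⁵'s header.

PRINT-DATUM TWIN (FLAG №16 ∕ LOCATE-HSEAM 5d3298b8d191f169; S1c of the (E1)∕(iii-b) work plan, director-ym №338∕№339) of the parent named in the imports, which stays landed and true on its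
own text (a conditional displaying HSEAM; cf. `not_hseam` ✓p765776): the SAME statement with (i) the conclusion `Prop8RegSepTopStepGB F N suppDom Adm (lamDatum F) (dataSmall7LamTopOf F N) …`
(F0c ✓p765717 ∕ P0 ✓p766390: print's [II] (2.3) datum «Λ_j = Ω_j^{(j)} ∖ Ω_{j+1}^{(j)} … for the sets of sites and the sets of bonds», p. 224 — ruling (α): the DIFFERENCE of the bond sets,
inward connectors belong to no `Λ_j` — and print's (7) data on `Λ`, [15] p. 278 L20–33), (ii) the HSEAM binder ABSENT — HONESTY GUARD №338 (5): the ONLY displayed premise removed, made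
definitionally redundant by the datum change (at `lamDatum` the knit's own fibre rows ARE the (2.3)-cell agreement and print's cell-form criticality; 77c⁵′ᴮ p766698 derives them) — and
(iii) the suppliers replaced by their print-datum twins (122′ `…OfLettersSym152EGB`, 117′ᴮ ✓p766391 `hA1_lam_freeB`, 99″ᴮ `…SymHQnearB`); every numeric letter, guard, constant and the
conditional premise `hT : HThm4RecSym152PhiEG …` (datum-free) byte-identical; proof = the parent's with three names swapped.  Seat `pub-ymgap-dag-n07-e` g34; `--kind proof --supports
stmt-QuantumFields-20541 --as helper` (K0⁷); count-neutral; def-free.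
HONEST SCOPE.  By-name composition; `HThm4RecSym152PhiEG` CONDITIONAL (N05's (B′) road + the cross-term bound); NO stub registered or closed; K0⁷ ∕ K1⁹ NOT closed; N07 NOT discharged; counts
unmoved (typed 28∕28 · discharged 8∕28); one finite 𝕋⁴ programme at fixed ε — the route closes the conditional finite-𝕋⁴ rung `BalabanLadder.UV` ONLY; the YM mass gap (Clay) is NOT proved by
any of this; nothing continuum ∕ ℝ⁴ ∕ OS.  No `sorry` ∕ `def` ∕ `instance` ∕ `notation`.  PARENT's HEADER FOLLOWS (theorem names carry the suffix `B`∕`_lam` here).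

Cell `pub-ymgap`, seat `pub-ymgap-dag-n07-e` g32 (FAN-OUT §N07 row s3; LANE OWNER of the K0 road chart side).  `--kind proof --supports stmt-QuantumFields-20541 --as helper` (K0⁷);
count-neutral; ONE theorem (0 `def`).  [15] = [Balaban1985Variational]; [6] = [Balaban1985RegularSpaces]; [3] = [Balaban1985Averaging]; [4] = [Balaban1984PropagatorsII]; [I] = [Balaban1987RG1].

WHAT IS PROVED (sorry-free; axioms standard).  ★★★ `prop8RegSepTopStepG_of_hThm4RecSym152PhiEG_cprime_dprime (F N)` — 100⁵'s statement at the G premise; the chart side of the K0 road under the candidate (β′)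
is thereby COMPLETE modulo its displayed inputs: the conditional premise `HThm4RecSym152PhiEG … (F.L * Mh) …` (N05's (B′) road), HSEAM (R4), and the K0 assembler's numerics (guards + ONE budget row whose
δ-part is `C·δ_j`-type and whose `Ω`∕UST parts are ε²-type).
HONEST LABEL (binding).  `HThm4RecSym152PhiEG` is a CONDITIONAL premise (print-licensed [I] pp. 253–254 for the structure; (B′) = variant, our proof; its cross-term bound (B′-5)′ in
progress on N05's pen); HSEAM is a displayed HYPOTHESIS ((ii)-docket); the budget row and the numerics are the K0 assembler's; nothing of [15]∕[6]∕[3]∕[4] ANALYSIS asserted beyond the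
cited modules; NO stub registered or closed here; K0⁷ ∕ K1⁹ NOT closed; N07 NOT discharged and NOT claimable; counts unmoved (typed 28∕28 · discharged 8∕28); one finite 𝕋⁴ programme at
fixed ε — the route closes the conditional finite-𝕋⁴ rung `BalabanLadder.UV` ONLY; the YM mass gap (Clay) is NOT proved by any of this; nothing continuum ∕ ℝ⁴ ∕ OS.  No `def`, no
`instance`, no `notation`, no `sorry`.

References: [15] Prop. 8 p. 304, (144) p. 300, (147)–(159) pp. 301–303, (160)–(168) pp. 303–304; [6] Thm. 4 p. 88, Prop. 6 (1.130)–(1.138) p. 99; [3] (26) p. 22, (78)–(81) p. 30,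
Prop. 4 (134)–(135) p. 38; [4] (2.1)–(2.4) p. 224; [I] (0.4), (0.6), (0.11) p. 253.
-/

set_option autoImplicit false

noncomputable section

open scoped BigOperators Matrix.Norms.L2Operator

namespace Summit.QuantumFields.YangMills.BalabanUVNodes.N07Prop8StepTokenOfRecordSym152EGCprimeDprimeB

open Literature.MathematicalPhysics.QuantumFieldTheory.Balaban1983to89
open Literature.MathematicalPhysics.QuantumFieldTheory.Balaban1983to89.Node00
open Literature.MathematicalPhysics.QuantumFieldTheory.Balaban1983to89.B15DeterminingSets
open Literature.MathematicalPhysics.QuantumFieldTheory.Balaban1983to89.B15DeterminingSetsB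
open T4Continuum (T4Family)
open GaugeField (gaugeAct)
open ExpMeanLog (deltaSU)
open FederbushMean (federbushSU deltaFed)
open B8Eq131Cubes (crad)
open Summit.QuantumFields.YangMills.BalabanUVNodes.N07Thm4RecordStructureSym152PhiEG (HThm4RecSym152PhiEG)
open Summit.QuantumFields.YangMills.BalabanUVNodes.N07Prop8StepTokenOfRecordOfLettersSym152EGB (prop8RegSepTopStepGB_of_hThm4RecSym152EG_of_lettersB)
open Summit.QuantumFields.YangMills.BalabanUVNodes.N07HA1LamFreeB (hA1_lam_freeB)
open Summit.QuantumFields.YangMills.BalabanUVNodes.N07SymHQnearPhiEB (hQnear_symPhiEB_of_guards)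

set_option maxHeartbeats 1600000 in
open scoped Classical in
/-- ★★★ **THE GUARDED [15] PROP. 8 STEP TOKEN OF RECORD, SYMMETRIC CURRENCY, (c′) AND (d′)-Lam DISCHARGED — AT PRINT's [II] (2.3) DATUM AND PRINT's (7) DATA, NO SEAM** (print-datum twin of
`prop8RegSepTopStepG_of_hThm4RecSym152PhiEG_cprime_dprime`, FLAG №16 ∕ LOCATE-HSEAM 5d3298b8d191f169; the (b)-instance stays landed and true on its own text; HSEAM binder absent, conclusion
`Prop8RegSepTopStepGB … (lamDatum F) (dataSmall7LamTopOf F N) …`, suppliers 122′ ∕ 117′ᴮ ∕ 99″ᴮ) (twin of ✓p748785's `prop8RegSepTopStepG_of_hThm4RecSym152PhiE_cprime_dprime`: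
`hT`'s type is (c-ii)‴ at modulus `L·Mh`, the composition calls MODULE 122; every other byte identical; statement in 100⁵'s header).
[cite: Balaban1985Variational, Prop. 8 p.304, (144) p.300, (147)–(159) pp.301–303, (160)–(168) pp.303–304; Balaban1985RegularSpaces, Thm. 4 p.88, Prop. 6 (1.130)–(1.138) p.99; Balaban1985Averaging, (26) p.22, (78)–(81) p.30, Prop. 4 (134)–(135) p.38; Balaban1984PropagatorsII, (2.1)–(2.4) p.224; Balaban1987RG1, (0.4), (0.6), (0.11) p.253] -/
theorem prop8RegSepTopStepGB_of_hThm4RecSym152PhiEG_cprime_dprime_lam (F : T4Family) (N : ℕ) [NeZero N] :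
    ∃ (Mh₀ R₀ : ℕ) (CH δH BH C₁ τ : ℝ), 0 ≤ CH ∧ 0 < δH ∧ 0 < BH ∧ 0 ≤ C₁ ∧ 0 < τ ∧
    ∀ {ρ : ℕ}
      {Mc Mh R a' : ℕ} (_ : 1 ≤ Mc) (_ : Mc ≤ ρ) (_ : Mh = F.L ^ a') (_ : Mh₀ ≤ Mh) (_ : R₀ ≤ R) (_ : F.L * Mh ∣ ρ) (_ : R * (F.L * Mh) ≤ ρ) (hLρ : F.L ≤ ρ)
      (_ : 2 * F.L ≤ R * (F.L * Mh) + 1)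
      {c c₀ : ℕ} (_ : (11 * 4 + 4 * ρ + Mc + 3) * F.L ≤ c) (_ : Mc + 11 * 4 + 6 * ρ + 1 ≤ 2 * F.L ^ c₀) (_ : F.m ≤ c₀) (_ : a' + 3 ≤ c₀)
      (Adm : StepGuard F) (_ : ∀ (ν : Stage7Numerics) (M : ℕ) (g : ℕ → ℝ) (K k : ℕ) (s : SeqOfRecord F ν M g K k), Adm ν M g K k s → c ≤ ν.M₁ ∧ k + c₀ ≤ F.m + K)
      (_ : ∀ (ν : Stage7Numerics) (M : ℕ) (g : ℕ → ℝ) (K k : ℕ) (s : SeqOfRecord F ν M g K k), Adm ν M g K k s → ∀ j : ℕ, 1 ≤ j → j ≤ k →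
        F.L * Mh ∣ M * RkOfRecord (F.P K).L ν.r (g j) ∧ dCubeSide (F.P K).L M (RkOfRecord (F.P K).L ν.r (g j)) j ∣ (F.P K).sitesPerDir 0)
      {B₃ C θ Q κ a₀ a₁ : ℝ} {Ψ : (ℕ → ℝ) → ℕ → ℝ} (_ : 0 < B₃) (_ : 0 ≤ C) (_ : 0 ≤ θ) (_ : 0 ≤ Q) (_ : 0 < κ)
      (_ : 2 * (F.L : ℝ) ^ 2 ≤ B₃) (_ : 4 * C ≤ B₃) (_ : 16 * θ ≤ 1) (_ : (16 * Q + 1024 * κ ^ 2) * a₀ ≤ 1) (_ : 32 * κ * a₀ ≤ 1)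
      -- ★ THE (d′) SUPPLIER's SMALLNESS LETTER (MODULE 117′): `κ·a₀ ≤ τ`
      (_ : κ * a₀ ≤ τ)
      -- ★ (c′)'s NUMERIC GUARDS (MODULE 99′): on `a₀` (dictionary ∕ UST ∕ φ-letter budgets), on `a₁` (MODULE 68's `δ_N`-guard, the sym within-block guard), and the range
      (_ : 243200 * (((4 + 2) * F.L : ℕ) : ℝ) ^ 2 * (κ * a₀ * (F.L : ℝ)) ≤ 1) (_ : 60 * (((4 + 2) * F.L : ℕ) : ℝ) ^ 2 * (κ * a₀ * (F.L : ℝ)) < deltaSU (Fin N))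
      (_ : 5760 * (((4 + 2) * F.L : ℕ) : ℝ) ^ 2 * (κ * a₀ * (F.L : ℝ)) < deltaFed (Fin N)) (_ : 2880 * (((4 + 2) * F.L : ℕ) : ℝ) ^ 2 * (κ * a₀ * (F.L : ℝ)) < deltaSU (Fin N))
      (_ : 240 * (((4 + 2) * F.L : ℕ) : ℝ) ^ 2 * (κ * a₀ * (F.L : ℝ)) ≤ 1 / 10000)
      (_ : ((((4 + 2) * F.L : ℕ) : ℝ) ^ 2 / 4) * ((4 * (((4 - 1 : ℕ) : ℝ) * ((2 * F.L - 1 : ℕ) : ℝ)) + 1) * a₁) < deltaSU (Fin N))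
      (_ : 2 * (((4 * ((F.L - 1) / 2) : ℕ) : ℝ) * ((((4 - 1 : ℕ) : ℝ) * ((F.L - 1 : ℕ) : ℝ)) * a₁)) < (federbushSU (n := Fin N)).δ)
      -- ★ THE DEFECT's GUARDS per level (99″): sign, size, range
      (_ : ∀ (ε : ℕ → ℝ) (j : ℕ), 0 ≤ ε j → ε j ≤ a₀ → 0 ≤ Ψ ε j ∧ Ψ ε j ≤ 1 / 32 ∧
        (((4 - 1 : ℕ) : ℝ) * ((crad (ρ * ((Mc + 11 * 4) / ρ + 2)) ρ : ℕ) : ℝ) * (1 + 2 * (((F.L : ℝ) ^ 2 + 6 * (((4 + 2) * F.L : ℕ) : ℝ) ^ 2) * (4 * (((4 - 1 : ℕ) : ℝ) * ((2 * F.L - 1 : ℕ) : ℝ)) + 1))) + 14 * ((((4 + 2) * F.L : ℕ) : ℝ) ^ 2 / 4 * (4 * (((4 - 1 : ℕ) : ℝ) * ((2 * F.L - 1 : ℕ) : ℝ)) + 1)) + 2 * (((4 + 1) * (F.L - 1) : ℕ) : ℝ) * ((((14 * (4 * ((F.L - 1) / 2)) + 1 : ℕ) : ℝ)) * (((4 -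 1 : ℕ) : ℝ) * ((F.L - 1 : ℕ) : ℝ)))) * a₁ +
          2 * ((100 * (240 * (((4 + 2) * F.L : ℕ) : ℝ) ^ 2 * (κ * ε j * (F.L : ℝ))) ^ 2 + 6 * Ψ ε j + 100 * (240 * (((4 + 2) * F.L : ℕ) : ℝ) ^ 2 * (κ * ε j * (F.L : ℝ))) ^ 2 * (6 * Ψ ε j)) + (100 * (240 * (((4 + 2) * F.L : ℕ) : ℝ) ^ 2 * (κ * ε j * (F.L : ℝ))) ^ 2 + 6 * Ψ ε j + 100 * (240 * (((4 + 2) * F.L : ℕ) : ℝ) ^ 2 * (κ * ε j * (F.L : ℝ))) ^ 2 * (6 * Ψ ε j)) + (100 * (240 * (((4 + 2) * F.L : ℕ) : ℝ) ^ 2 * (κ * ε j * (F.L : ℝ))) ^ 2 + 6 * Ψ ε j + 100 * (240 * (((4 + 2) * F.L : ℕ) : ℝ) ^ 2 * (κ * ε j * (F.L : ℝ))) ^ 2 * (6 * Ψ ε j)) * (100 * (240 * (((4 + 2) * F.L : ℕ) : ℝ) ^ 2 * (κ * ε j * (F.L : ℝ))) ^ 2 + 6 * Ψ ε j + 100 *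 (240 * (((4 + 2) * F.L : ℕ) : ℝ) ^ 2 * (κ * ε j * (F.L : ℝ))) ^ 2 * (6 * Ψ ε j))) ≤ 1 / 2)
      -- ★ HBUDGET of record (RANGED, CLOSED FORM) at 99′'s `β₁`, `β₂ := κ·L·ε_j`, `θ_H := 8C_H B_H e^{−δ_H ρ}`
      (_ : ∀ (K : ℕ) (ε δ : ℕ → ℝ) (j : ℕ), 0 < δ j → δ j ≤ a₁ → B₃ * δ j ≤ ε j → ε j ≤ a₀ →
        C₁ * (κ * ε j) ^ 2 + 1 / 4 * ((sideP (F.P K) Mc ρ : ℕ) : ℝ) *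
            max (4 * CH * BH * ((fun (ε δ : ℕ → ℝ) (j : ℕ) => (F.L : ℝ) * (2 * ((((4 - 1 : ℕ) : ℝ) * ((crad (ρ * ((Mc + 11 * 4) / ρ + 2)) ρ : ℕ) : ℝ) * (1 + 2 * (((F.L : ℝ) ^ 2 + 6 * (((4 + 2) * F.L : ℕ) : ℝ) ^ 2) * (4 * (((4 - 1 : ℕ) : ℝ) * ((2 * F.L - 1 : ℕ) : ℝ)) + 1))) + 14 * ((((4 + 2) * F.L : ℕ) : ℝ) ^ 2 / 4 * (4 * (((4 - 1 : ℕ) : ℝ) * ((2 * F.L - 1 : ℕ) : ℝ)) + 1)) + 2 * (((4 + 1) * (F.L - 1) : ℕ) : ℝ) * ((((14 * (4 * ((F.L - 1) / 2)) + 1 : ℕ) : ℝ)) * (((4 - 1 : ℕ) : ℝ) * ((F.L - 1 : ℕ) : ℝ)))) * δ j + ((100 * (240 * (((4 + 2) * F.L : ℕ) : ℝ) ^ 2 * (κ * ε j * (F.L : ℝ))) ^ 2 + 6 * Ψ ε j + 100 * (240 * (((4 + 2) * F.L : ℕ) : ℝ) ^ 2 * (κ * ε j * (F.L : ℝ)))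 ^ 2 * (6 * Ψ ε j)) + (100 * (240 * (((4 + 2) * F.L : ℕ) : ℝ) ^ 2 * (κ * ε j * (F.L : ℝ))) ^ 2 + 6 * Ψ ε j + 100 * (240 * (((4 + 2) * F.L : ℕ) : ℝ) ^ 2 * (κ * ε j * (F.L : ℝ))) ^ 2 * (6 * Ψ ε j)) + (100 * (240 * (((4 + 2) * F.L : ℕ) : ℝ) ^ 2 * (κ * ε j * (F.L : ℝ))) ^ 2 + 6 * Ψ ε j + 100 * (240 * (((4 + 2) * F.L : ℕ) : ℝ) ^ 2 * (κ * ε j * (F.L : ℝ))) ^ 2 * (6 * Ψ ε j)) * (100 * (240 * (((4 + 2) * F.L : ℕ) : ℝ) ^ 2 * (κ * ε j * (F.L : ℝ))) ^ 2 + 6 * Ψ ε j + 100 * (240 * (((4 + 2) * F.L : ℕ) : ℝ) ^ 2 * (κ * ε j * (F.L : ℝ))) ^ 2 * (6 * Ψ ε j))) * (1 + (((4 - 1 : ℕ) : ℝ) * ((crad (ρ * ((Mc + 11 * 4) / ρ + 2)) ρ : ℕ) : ℝ) * (1 + 2 * (((F.L : ℝ) ^ 2 + 6 * (((4 + 2)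 * F.L : ℕ) : ℝ) ^ 2) * (4 * (((4 - 1 : ℕ) : ℝ) * ((2 * F.L - 1 : ℕ) : ℝ)) + 1))) + 14 * ((((4 + 2) * F.L : ℕ) : ℝ) ^ 2 / 4 * (4 * (((4 - 1 : ℕ) : ℝ) * ((2 * F.L - 1 : ℕ) : ℝ)) + 1)) + 2 * (((4 + 1) * (F.L - 1) : ℕ) : ℝ) * ((((14 * (4 * ((F.L - 1) / 2)) + 1 : ℕ) : ℝ)) * (((4 - 1 : ℕ) : ℝ) * ((F.L - 1 : ℕ) : ℝ)))) * δ j)) + 64 * 60800 * (((4 + 2) * F.L : ℕ) : ℝ) ^ 2 * (κ * ε j * (F.L : ℝ)) ^ 2)) ε δ j)) (8 * CH * BH * Real.exp (-(δH * (ρ : ℝ))) * (κ * (F.L : ℝ) * ε j)) <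
          C * δ j + θ * ε j + Q * ε j ^ 2)
      -- ★ THE ONE CONDITIONAL PREMISE, GUARD EDITION (c-ii)‴ (candidate (β′)): `HThm4RecSym152PhiEG` at modulus `L·Mh`
      (hT : HThm4RecSym152PhiEG F N Mc ρ (F.L * Mh) κ a₀ Ψ),
      Prop8RegSepTopStepGB F N (fun ν K Ω => suppDomOfRecord F ν K Ω) Adm (lamDatum F) (dataSmall7LamTopOf F N) B₃ a₀ a₁ := by
  obtain ⟨Mh₀, R₀, CH, δH, BH, hCH, hδH, hBH, hmain⟩ := prop8RegSepTopStepGB_of_hThm4RecSym152EG_of_lettersB F N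
  obtain ⟨Mh₁, R₁, C₁, τ, hC₁, hτ, hd'⟩ := hA1_lam_freeB F N
  refine ⟨max Mh₀ Mh₁, max R₀ R₁, CH, δH, BH, C₁, τ, hCH, hδH, hBH, hC₁, hτ, ?_⟩
  intro ρ Mc Mh R a' hMc hMcρ hMha hMh hR hdvd hRρ hLρ hRM c c₀ hc hc₀ hmc₀ hac₀ Adm hAdm₁ hAdm₂ B₃ C θ Q κ a₀ a₁ Ψ hB₃ hC0 hθ0 hQ0 hκ
    hB₃L hC hθ ha hκa hκτ ha₀bud ha₀gd ha₀σF ha₀σS ha₀σ4 hguard hguardF hΨ hbudget hT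
  have hβ₁ : ∀ (ε δ : ℕ → ℝ) (j : ℕ), 0 < δ j → δ j ≤ a₁ → B₃ * δ j ≤ ε j → ε j ≤ a₀ → 0 ≤ (fun (ε δ : ℕ → ℝ) (j : ℕ) => (F.L : ℝ) * (2 * ((((4 - 1 : ℕ) : ℝ) * ((crad (ρ * ((Mc + 11 * 4) / ρ + 2)) ρ : ℕ) : ℝ) * (1 + 2 * (((F.L : ℝ) ^ 2 + 6 * (((4 + 2) * F.L : ℕ) : ℝ) ^ 2) * (4 * (((4 - 1 : ℕ) : ℝ) * ((2 * F.L - 1 : ℕ) : ℝ)) + 1))) + 14 * ((((4 + 2) * F.L : ℕ) : ℝ) ^ 2 / 4 * (4 * (((4 - 1 : ℕ) : ℝ) * ((2 * F.L - 1 : ℕ) : ℝ)) + 1)) + 2 * (((4 + 1) * (F.L - 1) : ℕ) : ℝ) * ((((14 * (4 * ((F.L - 1) / 2)) + 1 : ℕ) : ℝ)) * (((4 - 1 : ℕ) : ℝ) * ((F.L - 1 : ℕ) : ℝ)))) * δ j + ((100 * (240 * (((4 + 2) * F.L : ℕ) : ℝ) ^ 2 * (κ * ε j * (F.L : ℝ)))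 ^ 2 + 6 * Ψ ε j + 100 * (240 * (((4 + 2) * F.L : ℕ) : ℝ) ^ 2 * (κ * ε j * (F.L : ℝ))) ^ 2 * (6 * Ψ ε j)) + (100 * (240 * (((4 + 2) * F.L : ℕ) : ℝ) ^ 2 * (κ * ε j * (F.L : ℝ))) ^ 2 + 6 * Ψ ε j + 100 * (240 * (((4 + 2) * F.L : ℕ) : ℝ) ^ 2 * (κ * ε j * (F.L : ℝ))) ^ 2 * (6 * Ψ ε j)) + (100 * (240 * (((4 + 2) * F.L : ℕ) : ℝ) ^ 2 * (κ * ε j * (F.L : ℝ))) ^ 2 + 6 * Ψ ε j + 100 * (240 * (((4 + 2) * F.L : ℕ) : ℝ) ^ 2 * (κ * ε j * (F.L : ℝ))) ^ 2 * (6 * Ψ ε j)) * (100 * (240 * (((4 + 2) * F.L : ℕ) : ℝ) ^ 2 * (κ * ε j * (F.L : ℝ))) ^ 2 + 6 * Ψ ε j + 100 * (240 * (((4 + 2) * F.L : ℕ) : ℝ) ^ 2 * (κ * ε j * (F.L : ℝ))) ^ 2 * (6 * Ψ ε j))) * (1 + (((4 - 1 : ℕ) : ℝ) * ((crad (ρ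 * ((Mc + 11 * 4) / ρ + 2)) ρ : ℕ) : ℝ) * (1 + 2 * (((F.L : ℝ) ^ 2 + 6 * (((4 + 2) * F.L : ℕ) : ℝ) ^ 2) * (4 * (((4 - 1 : ℕ) : ℝ) * ((2 * F.L - 1 : ℕ) : ℝ)) + 1))) + 14 * ((((4 + 2) * F.L : ℕ) : ℝ) ^ 2 / 4 * (4 * (((4 - 1 : ℕ) : ℝ) * ((2 * F.L - 1 : ℕ) : ℝ)) + 1)) + 2 * (((4 + 1) * (F.L - 1) : ℕ) : ℝ) * ((((14 * (4 * ((F.L - 1) / 2)) + 1 : ℕ) : ℝ)) * (((4 - 1 : ℕ) : ℝ) * ((F.L - 1 : ℕ) : ℝ)))) * δ j)) + 64 * 60800 * (((4 + 2) * F.L : ℕ) : ℝ) ^ 2 * (κ * ε j * (F.L : ℝ)) ^ 2)) ε δ j := by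
    intro ε δ j hδ _ hBδ hεa
    have hδ0 : 0 ≤ δ j := hδ.le
    have hκ0 : 0 ≤ κ := hκ.le
    have hε0 : 0 ≤ ε j := le_trans (by positivity) hBδ
    have hψ0 : 0 ≤ Ψ ε j := (hΨ ε j hε0 hεa).1
    positivity
  exact hmain hMc hMcρ hMha ((le_max_left _ _).trans hMh) ((le_max_left _ _).trans hR) hdvd hRρ hLρ hc (by omega) hmc₀ hac₀ Adm hAdm₁ hAdm₂ hB₃ hC0 hθ0 hQ0 hκ hB₃L hC hθ ha hκa
    (fun (ε δ : ℕ → ℝ) (j : ℕ) => (F.L : ℝ) * (2 * ((((4 - 1 : ℕ) : ℝ) * ((crad (ρ * ((Mc + 11 * 4) / ρ + 2)) ρ : ℕ) : ℝ) * (1 + 2 * (((F.L : ℝ) ^ 2 + 6 * (((4 + 2) * F.L : ℕ) : ℝ) ^ 2) * (4 * (((4 - 1 : ℕ) : ℝ) * ((2 * F.L - 1 : ℕ) : ℝ)) + 1))) + 14 * ((((4 + 2) * F.L : ℕ) : ℝ) ^ 2 / 4 * (4 * (((4 - 1 : ℕ) : ℝ) * ((2 * F.L - 1 : ℕ) : ℝ))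 + 1)) + 2 * (((4 + 1) * (F.L - 1) : ℕ) : ℝ) * ((((14 * (4 * ((F.L - 1) / 2)) + 1 : ℕ) : ℝ)) * (((4 - 1 : ℕ) : ℝ) * ((F.L - 1 : ℕ) : ℝ)))) * δ j + ((100 * (240 * (((4 + 2) * F.L : ℕ) : ℝ) ^ 2 * (κ * ε j * (F.L : ℝ))) ^ 2 + 6 * Ψ ε j + 100 * (240 * (((4 + 2) * F.L : ℕ) : ℝ) ^ 2 * (κ * ε j * (F.L : ℝ))) ^ 2 * (6 * Ψ ε j)) + (100 * (240 * (((4 + 2) * F.L : ℕ) : ℝ) ^ 2 * (κ * ε j * (F.L : ℝ))) ^ 2 + 6 * Ψ ε j + 100 * (240 * (((4 + 2) * F.L : ℕ) : ℝ) ^ 2 * (κ * ε j * (F.L : ℝ))) ^ 2 * (6 * Ψ ε j)) + (100 * (240 * (((4 + 2) * F.L : ℕ) : ℝ) ^ 2 * (κ * ε j * (F.L : ℝ))) ^ 2 + 6 * Ψ ε j + 100 * (240 * (((4 + 2) * F.L : ℕ) : ℝ) ^ 2 * (κ * ε j * (F.L : ℝ))) ^ 2 * (6 * Ψ ε j)) *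 (100 * (240 * (((4 + 2) * F.L : ℕ) : ℝ) ^ 2 * (κ * ε j * (F.L : ℝ))) ^ 2 + 6 * Ψ ε j + 100 * (240 * (((4 + 2) * F.L : ℕ) : ℝ) ^ 2 * (κ * ε j * (F.L : ℝ))) ^ 2 * (6 * Ψ ε j))) * (1 + (((4 - 1 : ℕ) : ℝ) * ((crad (ρ * ((Mc + 11 * 4) / ρ + 2)) ρ : ℕ) : ℝ) * (1 + 2 * (((F.L : ℝ) ^ 2 + 6 * (((4 + 2) * F.L : ℕ) : ℝ) ^ 2) * (4 * (((4 - 1 : ℕ) : ℝ) * ((2 * F.L - 1 : ℕ) : ℝ)) + 1))) + 14 * ((((4 + 2) * F.L : ℕ) : ℝ) ^ 2 / 4 * (4 * (((4 - 1 : ℕ) : ℝ) * ((2 * F.L - 1 : ℕ) : ℝ)) + 1)) + 2 * (((4 + 1) * (F.L - 1) : ℕ) : ℝ) * ((((14 * (4 * ((F.L - 1) / 2)) + 1 : ℕ) : ℝ)) * (((4 - 1 : ℕ) : ℝ) * ((F.L - 1 : ℕ) : ℝ)))) * δ j)) + 64 * 60800 * (((4 + 2) * F.L : ℕ) : ℝ)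 ^ 2 * (κ * ε j * (F.L : ℝ)) ^ 2)) (fun (ε _ : ℕ → ℝ) (j : ℕ) => C₁ * (κ * ε j) ^ 2) hβ₁ hbudget hT
    (hQnear_symPhiEB_of_guards F N hMc hMha hdvd hRρ hLρ hc hc₀ hac₀ Adm hAdm₁ hAdm₂ hRM hB₃ hκ.le ha₀bud ha₀gd ha₀σF ha₀σS ha₀σ4 hguard hguardF hΨ)
    (hd' (dataSmall7LamTopOf F N) hMha ((le_max_right _ _).trans hMh) ((le_max_right _ _).trans hR) hdvd hRρ hLρ hc (by omega) hmc₀ hac₀ Adm hAdm₁ hAdm₂ hB₃ hκ hκτ)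

end Summit.QuantumFields.YangMills.BalabanUVNodes.N07Prop8StepTokenOfRecordSym152EGCprimeDprimeB

end
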